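import Literature.Barriers.Parity.SiegelZeroDichotomy
import Literature.NumberTheory.LFunctions.ZeroGaps
import HarnessLib
import Summits.Parity.GeneralizedHardyLittlewood.Theorems.UnboundedSiegelZeros

/-!
# Siegel zeros imply small gaps between zeros of `ζ` on RH: `μ < 0.4733`
# (Bondarenko–Heap 2026, Definition 1, Theorem 1, Corollary 2)

Topic `Literature/NumberTheory/LFunctions` (namespace `Literature.NumberTheory.LFunctions`).
STATEMENT LAYER for the cell `parity-realchar` (SIEGEL INSTRUMENT, deliverable "illusory-world
conditionals", input of 2026-08-25 from the frontier director): ONE claim of an unrefereed preprint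
(D-0012: `[claim: …, status: under-review]`, a closed `Prop` taken as a hypothesis, not proved here)
and PROVED bookkeeping around it. Nothing asserts that Siegel zeros exist, nor RH.

## What the source prints (held text `paper:arxiv-2608.07399`, v1 of 7 Aug 2026, read 2026-08-25)

A. Bondarenko, W. Heap, *Siegel zeros and small gaps between zeros of the Riemann zeta function*,
arXiv:2608.07399, §1 (pp. 1–2): "ordering the vertical zero ordinates by `γ_n`, define the
quantities `μ = lim inf_{n→∞} (γ_{n+1} − γ_n)/(2π/log γ_n)`, `λ = lim sup_{n→∞} …`. A longstanding
conjecture states that `μ = 0` and `λ = ∞`. … on RH, `λ > 3.18` due to Bui–Milinovich [2] and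
`μ < 0.50895` due to a recent breakthrough of Inoue [17]. … **Definition 1 (Siegel zero).** A Siegel
zero is a real number `β` associated to a primitive quadratic Dirichlet character `χ` modulo `q`
such that `L(β, χ) = 0` and `β = 1 − 1/(E log q)` with `E ≥ 3`. The quantity `E` is referred to as
the quality of `β`. We refer to an infinite family `(β_j, χ_j, q_j, E_j)` with `q_j → ∞` as an
exceptional sequence. … **Theorem 1.** Assume RH and that there exists an exceptional sequence of
Siegel zeros with `E = inf_j E_j` sufficiently large. Then `μ < 0.4733`. … **Corollary 2.** Assume
RH and suppose the existence of an exceptional sequence with `E = inf_j E_j` sufficiently large.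
Then an asymptotic distribution of the form `(γ_{n+1} − γ_n)/(2π/log γ_n) ∈ ½ℤ_{≥1} + o(1)` cannot
exist. That is, in a strong alternative distribution `½ℤ + o(1)`, zeros cannot all exist in
isolation and there must be some clustering on a normalised `o(1)` level." Abstract: "we show that
an infinite family of Siegel zeros implies `lim inf_{n→∞} (γ_{n+1} − γ_n) log(γ_n)/2π < 0.4733` on
RH. This refutes the existence of certain strong alternative hypotheses under these assumptions."

## Lean rendering / design choices

* `γ_n` = `Literature.NumberTheory.LFunctions.zetaOrdinate n` (0-indexed, with multiplicity) and
  the normalised gap `δ_n = (γ_{n+1} − γ_n)/(2π/log γ_n)` = `zetaNormalizedGap n` (tree,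
  `ZeroGaps.lean`, the vocabulary of `selberg_fujii_small_gaps`). "`μ < c`" (`μ = lim inf δ_n`) is
  rendered WITHOUT `Filter.liminf` as `ZetaGapLiminfBelow c`: some `c' < c` has `δ_n ≤ c'` for
  infinitely many `n` (`∃ᶠ n in atTop`) — equivalent to `lim inf δ_n < c` for the bounded-below
  sequence `δ_n ≥ 0`, and free of the conditionally-complete-lattice conventions.
* RH = Mathlib's `RiemannHypothesis`.
* Definition 1 with `E ≥ 10` is the tree's `Literature.Barriers.Parity.IsSiegelZero χ E`
  (Tao–Teräväinen, Definition 1.4, threshold `10` instead of `3`); since the theorem needs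
  `E = inf_j E_j` "sufficiently large", the threshold is immaterial and we use `IsSiegelZero`.
  "There exists an exceptional sequence (`q_j → ∞`) with `inf_j E_j ≥ E₀`" ⟺ Siegel zeros of
  quality `≥ E₀` occur at arbitrarily large conductors: `SiegelZerosOfQuality E₀` (parametrised
  predicate; `∀ E₀, SiegelZerosOfQuality E₀` is literally the tree's registered open hypothesis
  `Literature.Barriers.Parity.UnboundedSiegelZeros`, proved below).
* "with `E` sufficiently large": `∃ E₀` (absolute) in front of the implication; we also ask
  `E₀ ≥ 10` (harmless: a larger threshold is a weaker theorem).
* Corollary 2's "asymptotic distribution `δ_n ∈ ½ℤ_{≥1} + o(1)`" is the predicate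
  `HalfIntegerGapDistribution`: for every `ε > 0`, eventually every `δ_n` is within `ε` of some
  `k/2`, `k ≥ 1`.

PROVED here: `unboundedSiegelZeros_iff_forall_quality`; Theorem 1 ⟹ the director's shape
`UnboundedSiegelZeros → RiemannHypothesis → ZetaGapLiminfBelow 0.4733`
(`zetaGapLiminfBelow_of_unboundedSiegelZeros`); Corollary 2 from Theorem 1
(`bondarenkoHeap2026_corollary2_of_theorem1`, since a half-integer gap distribution forces
`δ_n ≥ 1/2 − ε` eventually, incompatible with `δ_n ≤ c' < 0.4733` infinitely often); and the
CONTRAPOSITIVE of refutation value: on RH, `μ ≥ 0.4733` (e.g. a strong alternative hypothesis)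
bounds the quality of Siegel zeros at large conductors (`siegelZeroQuality_bounded_of_gaps`).

## References

* [BondarenkoHeap2026] A. Bondarenko, W. Heap, arXiv:2608.07399v1 (7 Aug 2026), Definition 1,
  Theorem 1, Corollary 2 — UNREFEREED (claim under review).
* [TaoTeravainen2021] Definition 1.4 (the tree's `IsSiegelZero`).
* [Titchmarsh1986] §9.25 (the tree's `zetaNormalizedGap`).
-/

noncomputable section

open Filter

namespace Literature.NumberTheory.LFunctions

open Literature.Barriers.Parity

/-! ### Vocabulary -/

/-- **`μ < c`** for `μ = lim inf_n δ_n`, `δ_n = (γ_{n+1} − γ_n)/(2π/log γ_n)` the normalised gaps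
between consecutive ordinates of the zeros of `ζ` (with multiplicity): some `c' < c` bounds `δ_n`
for infinitely many `n`. [cite: BondarenkoHeap2026, §1 (definition of μ)] -/
def ZetaGapLiminfBelow (c : ℝ) : Prop :=
  ∃ c' : ℝ, c' < c ∧ ∃ᶠ n in atTop, zetaNormalizedGap n ≤ c'

/-- **Siegel zeros of quality `≥ E₀` at arbitrarily large conductors** ("there exists an
exceptional sequence `(β_j, χ_j, q_j, E_j)`, `q_j → ∞`, with `inf_j E_j ≥ E₀`"): for every `q₀`
there is a primitive quadratic `χ` mod some `q ≥ q₀` and a quality `E ≥ E₀` with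
`L(1 − 1/(E log q), χ) = 0` (`IsSiegelZero χ E`, which also records `E ≥ 10`). A parametrised
hypothesis predicate, never asserted. [cite: BondarenkoHeap2026, Definition 1] -/
def SiegelZerosOfQuality (E₀ : ℝ) : Prop :=
  ∀ q₀ : ℕ, ∃ (q : ℕ) (_ : NeZero q) (χ : DirichletCharacter ℂ q) (E : ℝ),
    q₀ ≤ q ∧ E₀ ≤ E ∧ IsSiegelZero χ E

/-- **A strong alternative distribution `δ_n ∈ ½ℤ_{≥1} + o(1)`** (the object of Corollary 2): for
every `ε > 0`, for all large `n` the normalised gap `δ_n` is within `ε` of `k/2` for some integer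
`k ≥ 1`. A predicate (no instance asserted). [cite: BondarenkoHeap2026, Corollary 2] -/
def HalfIntegerGapDistribution : Prop :=
  ∀ ε : ℝ, 0 < ε → ∀ᶠ n in atTop, ∃ k : ℕ, 1 ≤ k ∧ |zetaNormalizedGap n - k / 2| ≤ ε

/-! ### The claims (unrefereed preprint; taken as hypotheses) -/

/-- **Bondarenko–Heap 2026, Theorem 1** (arXiv preprint, UNDER REVIEW): "Assume RH and that there
exists an exceptional sequence of Siegel zeros with `E = inf_j E_j` sufficiently large. Then
`μ < 0.4733`." Rendered: there is an absolute `E₀ ≥ 10` such that Siegel zeros of quality `≥ E₀`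
at arbitrarily large conductors and the Riemann Hypothesis imply `lim inf δ_n < 0.4733`. CLAIM of
an unrefereed source, not proved here. [claim: BondarenkoHeap2026, status: under-review] -/
def bondarenkoHeap2026_theorem1 : Prop :=
  ∃ E₀ : ℝ, 10 ≤ E₀ ∧
    (SiegelZerosOfQuality E₀ → RiemannHypothesis → ZetaGapLiminfBelow 0.4733)

/-- **Bondarenko–Heap 2026, Corollary 2** (arXiv preprint, UNDER REVIEW): "Assume RH and suppose the
existence of an exceptional sequence with `E = inf_j E_j` sufficiently large. Then an asymptotic
distribution of the form `(γ_{n+1} − γ_n)/(2π/log γ_n) ∈ ½ℤ_{≥1} + o(1)` cannot exist." Rendered with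
the same absolute threshold shape as Theorem 1; PROVED from Theorem 1 below
(`bondarenkoHeap2026_corollary2_of_theorem1`). [claim: BondarenkoHeap2026, status: under-review] -/
def bondarenkoHeap2026_corollary2 : Prop :=
  ∃ E₀ : ℝ, 10 ≤ E₀ ∧
    (SiegelZerosOfQuality E₀ → RiemannHypothesis → ¬ HalfIntegerGapDistribution)

/-! ### Bookkeeping (proved) -/

/-- Monotonicity: quality `≥ E₀'` at arbitrarily large conductors implies quality `≥ E₀` for
`E₀ ≤ E₀'`. [cite: BondarenkoHeap2026, Definition 1] -/
theorem SiegelZerosOfQuality.anti {E₀ E₀' : ℝ} (hle : E₀ ≤ E₀') (h : SiegelZerosOfQuality E₀') :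
    SiegelZerosOfQuality E₀ := by
  intro q₀
  obtain ⟨q, hq, χ, E, hq₀, hE, hS⟩ := h q₀
  exact ⟨q, hq, χ, E, hq₀, hle.trans hE, hS⟩

/-- **The tree's open hypothesis is "every quality occurs":**
`UnboundedSiegelZeros ↔ ∀ E₀, SiegelZerosOfQuality E₀` (definitional reshuffling).
[cite: TaoTeravainen2021, Definition 1.4 and Theorem 1.5] -/
theorem unboundedSiegelZeros_iff_forall_quality :
    Summit.Parity.GeneralizedHardyLittlewood.UnboundedSiegelZeros ↔ ∀ E₀ : ℝ, SiegelZerosOfQuality E₀ := by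
  constructor
  · intro h E₀ q₀
    obtain ⟨q, hq, χ, η, hq₀, hη, hS⟩ := h E₀ q₀
    exact ⟨q, hq, χ, η, hq₀, hη, hS⟩
  · intro h η₀ q₀
    obtain ⟨q, hq, χ, E, hq₀, hE, hS⟩ := h η₀ q₀
    exact ⟨q, hq, χ, E, hq₀, hE, hS⟩

/-- `ZetaGapLiminfBelow` is monotone in the bound. [cite: BondarenkoHeap2026, §1 (definition of μ)] -/
theorem ZetaGapLiminfBelow.mono {c c' : ℝ} (hcc : c ≤ c') (h : ZetaGapLiminfBelow c) :
    ZetaGapLiminfBelow c' := by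
  obtain ⟨c₀, hc₀, hf⟩ := h
  exact ⟨c₀, lt_of_lt_of_le hc₀ hcc, hf⟩

/-- **Theorem 1 in the director's shape**: Siegel zeros of unbounded quality (the antecedent of
Heath-Brown's dichotomy `Literature.Barriers.Parity.SiegelZeroTwinPrimes`) and RH give
`μ < 0.4733`, modulo the claim `bondarenkoHeap2026_theorem1`. [claim: BondarenkoHeap2026, status: under-review] -/
theorem zetaGapLiminfBelow_of_unboundedSiegelZeros (hBH : bondarenkoHeap2026_theorem1)
    (hU : Summit.Parity.GeneralizedHardyLittlewood.UnboundedSiegelZeros) (hRH : RiemannHypothesis) : ZetaGapLiminfBelow 0.4733 := by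
  obtain ⟨E₀, _, h⟩ := hBH
  exact h (unboundedSiegelZeros_iff_forall_quality.mp hU E₀) hRH

/-- **A half-integer gap distribution keeps `δ_n ≥ 1/2 − ε` eventually**, hence excludes
`lim inf δ_n < c` for every `c ≤ 1/2` — the one-line deduction of Corollary 2 from Theorem 1.
[cite: BondarenkoHeap2026, Corollary 2] -/
theorem not_zetaGapLiminfBelow_of_halfIntegerGapDistribution (h : HalfIntegerGapDistribution)
    {c : ℝ} (hc : c ≤ 1 / 2) : ¬ ZetaGapLiminfBelow c := by
  rintro ⟨c', hc', hf⟩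
  -- with `ε = (1/2 − c')/2 > 0`: eventually `δ_n ≥ k/2 − ε ≥ 1/2 − ε > c'`
  have hε2 : 0 < (1 / 2 - c') / 2 := by linarith
  have hstrict : ∀ᶠ n in atTop, c' < zetaNormalizedGap n := by
    filter_upwards [h ((1 / 2 - c') / 2) hε2] with n hn
    obtain ⟨k, hk, hkε⟩ := hn
    have hk1 : (1 : ℝ) ≤ k := by exact_mod_cast hk
    have habs := (abs_le.mp hkε).1
    linarith
  exact (hf.and_eventually hstrict).exists.elim fun n hn => absurd hn.1 (not_le.mpr hn.2)

/-- **Corollary 2 from Theorem 1** (with the same threshold `E₀`): `0.4733 < 1/2`.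
[claim: BondarenkoHeap2026, status: under-review] -/
theorem bondarenkoHeap2026_corollary2_of_theorem1 (hBH : bondarenkoHeap2026_theorem1) :
    bondarenkoHeap2026_corollary2 := by
  obtain ⟨E₀, hE₀, h⟩ := hBH
  refine ⟨E₀, hE₀, fun hS hRH hAH => ?_⟩
  exact not_zetaGapLiminfBelow_of_halfIntegerGapDistribution hAH (by norm_num) (h hS hRH)

/-- **The contrapositive (refutation value).** Modulo the claim: on RH, if `μ ≥ 0.4733` — i.e.
`¬ ZetaGapLiminfBelow 0.4733`, for instance under a half-integer alternative distribution — then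
Siegel zeros have BOUNDED quality at large conductors: there are `E₀` and `q₀` such that every
Siegel zero attached to a conductor `q ≥ q₀` has quality `< E₀`. (Compare
`Literature.Barriers.Parity.SiegelZeroTwinPrimes.disproof_bounds_quality`.)
[claim: BondarenkoHeap2026, status: under-review] -/
theorem siegelZeroQuality_bounded_of_gaps (hBH : bondarenkoHeap2026_theorem1) (hRH : RiemannHypothesis)
    (hμ : ¬ ZetaGapLiminfBelow 0.4733) :
    ∃ E₀ : ℝ, ∃ q₀ : ℕ, ∀ (q : ℕ) [NeZero q] (χ : DirichletCharacter ℂ q) (E : ℝ),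
      q₀ ≤ q → IsSiegelZero χ E → E < E₀ := by
  obtain ⟨E₀, _, h⟩ := hBH
  have hnot : ¬ SiegelZerosOfQuality E₀ := fun hS => hμ (h hS hRH)
  unfold SiegelZerosOfQuality at hnot
  push Not at hnot
  obtain ⟨q₀, hq₀⟩ := hnot
  refine ⟨E₀, q₀, fun q _ χ E hq hS => ?_⟩
  by_contra hle
  exact hq₀ q inferInstance χ E hq (not_lt.mp hle) hS

/-- In particular, modulo the claim, RH together with a half-integer alternative distribution
refutes `UnboundedSiegelZeros`. [claim: BondarenkoHeap2026, status: under-review] -/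
theorem not_unboundedSiegelZeros_of_halfIntegerGapDistribution (hBH : bondarenkoHeap2026_theorem1)
    (hRH : RiemannHypothesis) (hAH : HalfIntegerGapDistribution) : ¬ Summit.Parity.GeneralizedHardyLittlewood.UnboundedSiegelZeros :=
  fun hU => not_zetaGapLiminfBelow_of_halfIntegerGapDistribution hAH (by norm_num)
    (zetaGapLiminfBelow_of_unboundedSiegelZeros hBH hU hRH)


/-! ### Appended 2026-08-26: `ZetaGapLiminfBelow c` versus `lim inf δ_n < c`

The source defines `μ = lim inf_n δ_n`. Our hypothesis-free rendering `ZetaGapLiminfBelow c`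
("`δ_n ≤ c'` infinitely often for some `c' < c`") is EQUIVALENT to `Filter.liminf δ atTop < c`
whenever the sequence `δ_n` is bounded below (it is: `δ_n ≥ 0`, from the tree's named facts
`zetaOrdinate_mono` and `fourteen_lt_zetaOrdinate_zero`) and does not tend to `+∞` (cobounded; e.g.
by Selberg–Fujii's small gaps, the tree's `selberg_fujii_small_gaps`). Both order-theoretic side
conditions are taken as explicit hypotheses below, so no named fact enters; without coboundedness
Mathlib's `liminf` of a real sequence tending to `+∞` is the junk value `sSup univ`, which is why the
frequently-form was chosen as the definition. -/

/-- `δ_n ≥ 0` for every `n` (from the monotonicity of the ordinates and `γ_0 > 14`), hence the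
normalised gaps are bounded below along `atTop`. [cite: Titchmarsh1986, §9.25 (9.25.5)] -/
theorem isBoundedUnder_ge_zetaNormalizedGap (hmono : zetaOrdinate_mono)
    (h14 : fourteen_lt_zetaOrdinate_zero) :
    IsBoundedUnder (· ≥ ·) atTop zetaNormalizedGap := by
  refine ⟨0, Filter.eventually_map.mpr (Eventually.of_forall fun n => ?_)⟩
  have h1 : 1 ≤ zetaOrdinate n := by
    have h0 : zetaOrdinate 0 ≤ zetaOrdinate n := hmono (Nat.zero_le n)
    have : (14 : ℝ) < zetaOrdinate 0 := h14
    linarith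
  exact zetaNormalizedGap_nonneg (hmono (Nat.le_succ n)) h1

/-- **`ZetaGapLiminfBelow c → lim inf δ_n < c`** for a sequence bounded below along `atTop`.
[cite: BondarenkoHeap2026, §1 (definition of μ)] -/
theorem ZetaGapLiminfBelow.liminf_lt {c : ℝ} (h : ZetaGapLiminfBelow c)
    (hbdd : IsBoundedUnder (· ≥ ·) atTop zetaNormalizedGap) :
    Filter.liminf zetaNormalizedGap atTop < c := by
  obtain ⟨c', hc', hf⟩ := h
  exact lt_of_le_of_lt (Filter.liminf_le_of_frequently_le hf hbdd) hc'

/-- **`lim inf δ_n < c → ZetaGapLiminfBelow c`** for a sequence that is cobounded below along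
`atTop` (i.e. does not tend to `+∞`; e.g. `IsCoboundedUnder.of_frequently_le` from any
infinitely-often upper bound such as Selberg–Fujii's). [cite: BondarenkoHeap2026, §1 (definition of μ)] -/
theorem zetaGapLiminfBelow_of_liminf_lt {c : ℝ}
    (hcob : IsCoboundedUnder (· ≥ ·) atTop zetaNormalizedGap)
    (h : Filter.liminf zetaNormalizedGap atTop < c) : ZetaGapLiminfBelow c := by
  obtain ⟨c', hc'₁, hc'₂⟩ := exists_between h
  exact ⟨c', hc'₂, (Filter.frequently_lt_of_liminf_lt hcob hc'₁).mono fun n hn => hn.le⟩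

/-- **The equivalence** under both side conditions: `ZetaGapLiminfBelow c ↔ lim inf δ_n < c`.
[cite: BondarenkoHeap2026, §1 (definition of μ)] -/
theorem zetaGapLiminfBelow_iff_liminf_lt {c : ℝ}
    (hbdd : IsBoundedUnder (· ≥ ·) atTop zetaNormalizedGap)
    (hcob : IsCoboundedUnder (· ≥ ·) atTop zetaNormalizedGap) :
    ZetaGapLiminfBelow c ↔ Filter.liminf zetaNormalizedGap atTop < c :=
  ⟨fun h => h.liminf_lt hbdd, zetaGapLiminfBelow_of_liminf_lt hcob⟩

/-- **Theorem 1 with the printed `μ`**: modulo the claim, Siegel zeros of unbounded quality and RH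
give `lim inf_n δ_n < 0.4733` (Mathlib's `Filter.liminf`), granted that `δ_n` is bounded below
(tree facts `zetaOrdinate_mono`, `fourteen_lt_zetaOrdinate_zero`).
[claim: BondarenkoHeap2026, status: under-review] -/
theorem liminf_zetaNormalizedGap_lt_of_unboundedSiegelZeros (hBH : bondarenkoHeap2026_theorem1)
    (hmono : zetaOrdinate_mono) (h14 : fourteen_lt_zetaOrdinate_zero)
    (hU : Summit.Parity.GeneralizedHardyLittlewood.UnboundedSiegelZeros) (hRH : RiemannHypothesis) :
    Filter.liminf zetaNormalizedGap atTop < 0.4733 :=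
  (zetaGapLiminfBelow_of_unboundedSiegelZeros hBH hU hRH).liminf_lt
    (isBoundedUnder_ge_zetaNormalizedGap hmono h14)

end Literature.NumberTheory.LFunctions

end
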